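import Mathlib
import Literature.AlgebraicGeometry.Tropical.InitialIdeal
import Summits.ResolutionOfSingularities.ResolutionOfSingularities.Theorems.TropicalLinksInductiveStepRayDegenerationGen

/-!
# TropicalLinks / InductiveStep — initial ideals are invariant under positive rescaling of the weight
# (Gröbner dictionary, brick B5)

Route `ResolutionOfSingularities/TropicalLinks`, crux `InductiveStep` (stmt-ResolutionOfSingularities-17233),
line `split`, in support of stub `stub_sncClosureSchon`.  The schön clause quantifies over ALL integer
weights `w ∈ ℤ^n`; the dictionary reduces a nonzero weight to a PRIMITIVE one (brick B6) because the
initial form of `f` with respect to `w` only depends on the ORDER that `⟨w, ·⟩` induces on the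
exponents of `f` (min-convention initial forms of `Tropical/InitialIdeal`):

* `tropicalLinks_initialForm_comp_strictMono` (registered brick) — `in_{g ∘ φ}(f) = in_φ(f)` for any
  weight map `φ : M → Λ` and any strictly monotone `g : Λ → Λ'`;
* `tropicalLinks_initialIdeal_comp_strictMono` — the same for initial ideals;
* `tropicalLinks_weightInitialIdeal_smul_of_pos` — `in_{ℓ • w}(I) = in_w(I)` for an integer `ℓ > 0`.

Elementary (Maclagan–Sturmfels, *Introduction to Tropical Geometry*, §2.4); no new definitions.
-/

-- single-problem summit: the doubled namespace component `ResolutionOfSingularities` is forced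
set_option linter.dupNamespace false

namespace Summit.ResolutionOfSingularities.ResolutionOfSingularities.Theorems

open AddMonoidAlgebra Literature.AlgebraicGeometry.Tropical

/-- **Initial forms only see the order induced by the weight**: composing the weight map with a
strictly monotone map of linear orders does not change any initial form. [folklore] -/
theorem tropicalLinks_initialForm_comp_strictMono :
    ∀ (k : Type) [CommSemiring k] (M Λ Λ' : Type) [LinearOrder Λ] [LinearOrder Λ'] (φ : M → Λ) (g : Λ → Λ'), StrictMono g → ∀ f : AddMonoidAlgebra k M, Literature.AlgebraicGeometry.Tropical.initialForm (g ∘ φ) f = Literature.AlgebraicGeometry.Tropical.initialForm φ f := by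
  intro k _ M Λ Λ' _ _ φ g hg f
  unfold initialForm
  congr 1
  exact tropicalLinks_filter_congr f.coeff fun v =>
    forall₂_congr fun u _ => by rw [Function.comp_apply, Function.comp_apply, hg.le_iff_le]

/-- The same for initial ideals: `in_{g ∘ φ}(I) = in_φ(I)` for `g` strictly monotone. [folklore] -/
theorem tropicalLinks_initialIdeal_comp_strictMono {k : Type} [CommSemiring k] {M Λ Λ' : Type}
    [AddMonoid M] [LinearOrder Λ] [LinearOrder Λ'] (φ : M → Λ) {g : Λ → Λ'} (hg : StrictMono g)
    (I : Ideal (AddMonoidAlgebra k M)) : initialIdeal (g ∘ φ) I = initialIdeal φ I := by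
  unfold initialIdeal
  have h : initialForm (k := k) (g ∘ φ) = initialForm φ :=
    funext (tropicalLinks_initialForm_comp_strictMono k M Λ Λ' φ g hg)
  rw [h]

/-- The weight of a rescaled weight vector: `⟨ℓ • w, v⟩ = ℓ · ⟨w, v⟩`. [folklore] -/
theorem tropicalLinks_dotWeight_smul {n : ℕ} (ℓ : ℤ) (w v : Fin n → ℤ) :
    dotWeight (ℓ • w) v = ℓ * dotWeight w v := by
  simp only [dotWeight, Pi.smul_apply, smul_eq_mul, Finset.mul_sum, mul_assoc]

/-- **Positive rescaling of the weight does not change the initial ideal**: `in_{ℓ • w}(I) = in_w(I)`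
for an integer `ℓ > 0` (multiplication by `ℓ` is strictly monotone on `ℤ`). [folklore] -/
theorem tropicalLinks_weightInitialIdeal_smul_of_pos {k : Type} [CommSemiring k] {n : ℕ} {ℓ : ℤ}
    (hℓ : 0 < ℓ) (w : Fin n → ℤ) (I : Ideal (AddMonoidAlgebra k (Fin n → ℤ))) :
    weightInitialIdeal (ℓ • w) I = weightInitialIdeal w I := by
  have h : dotWeight (ℓ • w) = (fun x : ℤ => ℓ * x) ∘ dotWeight w :=
    funext fun v => tropicalLinks_dotWeight_smul ℓ w v
  rw [weightInitialIdeal, weightInitialIdeal, h]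
  exact tropicalLinks_initialIdeal_comp_strictMono (dotWeight w) (fun a b hab => by
    show ℓ * a < ℓ * b
    exact Int.mul_lt_mul_of_pos_left hab hℓ) I

end Summit.ResolutionOfSingularities.ResolutionOfSingularities.Theorems
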